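import Summits.KontsevichZagierPeriods.KontsevichZagierPeriods.Theorems.RealOnePeriodRelations.Negative.Kit
import Literature.NumberTheory.Transcendental.SemialgebraicMapsProofs
import Mathlib.MeasureTheory.Function.LocallyIntegrable
import Mathlib.LinearAlgebra.Determinant

/-!
# `stub_greenOnSquare` of line `nash-retraction-thin-strip` (crux stmt-KontsevichZagierPeriods-10042) — a proof

Drefute by-product (positive; evidence for the lead, not landed by the refuter): Green on the unit square
with degenerate vertical sides is two typed Green instances — the standard triangle `Δ` with the data
`(A, B, S)` restricted, and the point-reflected triangle with the data `(−A∘σ, −B∘σ, S∘σ)`,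
`σ(a,b) = (1−a, 1−b)` — plus rule 2 (`t ↦ 1 − t` on `(0,1)`, `|det| = 1`) and rule 1b bookkeeping.
The statement `greenOnSquare` below is the registered stub's type verbatim.
-/

noncomputable section

open scoped BigOperators Topology
open Set MeasureTheory Filter
open Literature.NumberTheory.Transcendental
open Literature.ModelTheory.ExponentialFields (IsSemialgebraic isSemialgebraic_setOf_eval_nonneg
  isSemialgebraic_setOf_eval_le isSemialgebraic_setOf_eval_pos isSemialgebraic_setOf_eval_eq_zero)
open Summit.KontsevichZagierPeriods.SymplecticScissors.RealOnePeriodRelationsNegative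

namespace Summit.KontsevichZagierPeriods.SymplecticScissors.RealOnePeriodRelations.GreenOnSquareProof

/-! ## §1 Sets -/

/-- The closed unit square. [folklore] -/
def Q : Set (Fin 2 → ℝ) := {p | 0 ≤ p 0 ∧ p 0 ≤ 1 ∧ 0 ≤ p 1 ∧ p 1 ≤ 1}

/-- `Q` is `ℚ`-semialgebraic. [folklore] -/
theorem isSemialgebraic_Q : IsSemialgebraic ℚ Q := by
  have h0 := isSemialgebraic_setOf_eval_nonneg (k := ℚ) (R := ℝ)
    (MvPolynomial.X (0 : Fin 2) : MvPolynomial (Fin 2) ℚ)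
  have h1 := isSemialgebraic_setOf_eval_le (k := ℚ) (R := ℝ)
    (MvPolynomial.X (0 : Fin 2) : MvPolynomial (Fin 2) ℚ) 1
  have h2 := isSemialgebraic_setOf_eval_nonneg (k := ℚ) (R := ℝ)
    (MvPolynomial.X (1 : Fin 2) : MvPolynomial (Fin 2) ℚ)
  have h3 := isSemialgebraic_setOf_eval_le (k := ℚ) (R := ℝ)
    (MvPolynomial.X (1 : Fin 2) : MvPolynomial (Fin 2) ℚ) 1
  have hQ : Q = (({x : Fin 2 → ℝ | 0 ≤ MvPolynomial.aeval x (MvPolynomial.X (0 : Fin 2) : MvPolynomial (Fin 2) ℚ)} ∩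
      {x : Fin 2 → ℝ | MvPolynomial.aeval x (MvPolynomial.X (0 : Fin 2) : MvPolynomial (Fin 2) ℚ) ≤
        MvPolynomial.aeval x (1 : MvPolynomial (Fin 2) ℚ)}) ∩
      {x : Fin 2 → ℝ | 0 ≤ MvPolynomial.aeval x (MvPolynomial.X (1 : Fin 2) : MvPolynomial (Fin 2) ℚ)}) ∩
      {x : Fin 2 → ℝ | MvPolynomial.aeval x (MvPolynomial.X (1 : Fin 2) : MvPolynomial (Fin 2) ℚ) ≤
        MvPolynomial.aeval x (1 : MvPolynomial (Fin 2) ℚ)} := by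
    ext p
    simp [Q, and_assoc]
  rw [hQ]
  exact ((h0.inter h1).inter h2).inter h3

/-- `Δ` (the Kit's standard triangle) is `ℚ`-semialgebraic. [folklore] -/
theorem isSemialgebraic_Δ' : IsSemialgebraic ℚ Δ := by
  have h0 := isSemialgebraic_setOf_eval_nonneg (k := ℚ) (R := ℝ)
    (MvPolynomial.X (0 : Fin 2) : MvPolynomial (Fin 2) ℚ)
  have h1 := isSemialgebraic_setOf_eval_nonneg (k := ℚ) (R := ℝ)
    (MvPolynomial.X (1 : Fin 2) : MvPolynomial (Fin 2) ℚ)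
  have h2 := isSemialgebraic_setOf_eval_le (k := ℚ) (R := ℝ)
    (MvPolynomial.X (0 : Fin 2) + MvPolynomial.X 1 : MvPolynomial (Fin 2) ℚ) 1
  have hΔ : Δ = ({x : Fin 2 → ℝ | 0 ≤ MvPolynomial.aeval x (MvPolynomial.X (0 : Fin 2) : MvPolynomial (Fin 2) ℚ)} ∩
      {x : Fin 2 → ℝ | 0 ≤ MvPolynomial.aeval x (MvPolynomial.X (1 : Fin 2) : MvPolynomial (Fin 2) ℚ)}) ∩
      {x : Fin 2 → ℝ | MvPolynomial.aeval x (MvPolynomial.X (0 : Fin 2) + MvPolynomial.X 1 : MvPolynomial (Fin 2) ℚ) ≤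
        MvPolynomial.aeval x (1 : MvPolynomial (Fin 2) ℚ)} := by
    ext p
    simp [Δ, and_assoc]
  rw [hΔ]
  exact (h0.inter h1).inter h2

/-- `Δ ⊆ Q`. [folklore] -/
theorem Δ_subset_Q : Δ ⊆ Q := by
  rintro p ⟨h0, h1, h2⟩
  exact ⟨h0, by linarith, h1, by linarith⟩

/-- `unitDom ⊆ [0,1]¹`. [folklore] -/
theorem unitDom_subset_Icc' : unitDom ⊆ Set.Icc (0 : Fin 1 → ℝ) 1 := by
  intro z hz
  have hz' : z 0 ∈ Set.Ioo (0 : ℝ) 1 := hz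
  refine ⟨fun i => ?_, fun i => ?_⟩
  · have : i = 0 := Subsingleton.elim i 0
    subst this
    simpa using hz'.1.le
  · have : i = 0 := Subsingleton.elim i 0
    subst this
    simpa using hz'.2.le

/-! ## §2 Semialgebraicity and integrability of edge traces -/

/-- A `ℚ`-semialgebraic function on `Q` composed with a `ℚ`-polynomial map `ℝ¹ ⊇ (0,1) → Q` is
`ℚ`-semialgebraic on `(0,1)`. [cite: BochnakCosteRoy1998, Prop. 2.2.6] -/
theorem sa_comp {F : (Fin 2 → ℝ) → ℝ} (hF : IsSemialgebraicFunOn ℚ Q F)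
    (m : (Fin 1 → ℝ) → (Fin 2 → ℝ)) (P : Fin 2 → MvPolynomial (Fin 1) ℚ)
    (hm : ∀ z, m z = fun j => MvPolynomial.aeval z (P j)) (hmaps : MapsTo m unitDom Q) :
    IsSemialgebraicFunOn ℚ unitDom (fun z => F (m z)) := by
  have hmap : IsSemialgebraicMapOn ℚ unitDom m :=
    (isSemialgebraicMapOn_aeval isSemialgebraic_unitDom P).congr fun z _ => (hm z).symm
  exact IsSemialgebraicFunOn.comp_isSemialgebraicMapOn_holds hF hmap hmaps

/-- A function continuous on `Q` composed with a continuous map `[0,1] → Q` gives an integrable trace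
on `(0,1) ⊂ ℝ¹`. [folklore] -/
theorem integrableOn_comp {F : (Fin 2 → ℝ) → ℝ} (hF : ContinuousOn F Q) (m : ℝ → (Fin 2 → ℝ))
    (hmc : Continuous m) (hmaps : ∀ t ∈ Set.Icc (0 : ℝ) 1, m t ∈ Q) :
    IntegrableOn (fun z : Fin 1 → ℝ => F (m (z 0))) unitDom volume := by
  have hcont : ContinuousOn (fun z : Fin 1 → ℝ => F (m (z 0))) (Set.Icc (0 : Fin 1 → ℝ) 1) := by
    refine hF.comp ((hmc.comp (continuous_apply 0)).continuousOn) ?_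
    intro z hz
    exact hmaps (z 0) ⟨by simpa using hz.1 0, by simpa using hz.2 0⟩
  exact (hcont.integrableOn_Icc).mono_set unitDom_subset_Icc'

/-- The representation `[∫_{(0,1)} φ]` of a semialgebraic integrable trace. [folklore] -/
def edgeRep (φ : (Fin 1 → ℝ) → ℝ) (hφ : IsSemialgebraicFunOn ℚ unitDom φ)
    (hint : IntegrableOn φ unitDom volume) : KZ.IntegralRep 1 :=
  ⟨unitDom, φ, isSemialgebraic_unitDom, hφ, hint⟩

/-! ## §3 Bookkeeping modulo `M₁` -/

/-- A representation whose integrand vanishes on its domain lies in `M₁`. [folklore] -/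
theorem of_mem_M₁_of_eqOn_zero' {n : ℕ} (r : KZ.IntegralRep n) (h : ∀ x ∈ r.domain, r.integrand x = 0) :
    KZ.of r ∈ M₁ := by
  have hrel : KZ.of r - KZ.of r - KZ.of r ∈ M₁ := by
    refine AddSubgroup.subset_closure (Or.inl (Or.inl (Or.inr ?_)))
    refine ⟨n, r, r, r, rfl, rfl, ?_, rfl⟩
    intro x hx
    simp [h x hx]
  have : KZ.of r - KZ.of r - KZ.of r = -KZ.of r := by abel
  rw [this] at hrel
  simpa using M₁.neg_mem hrel

/-- `[r] − [r′] ∈ M₁` when the domains agree and the integrands agree on them (rule 1b against a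
representation with zero integrand `z`). [folklore] -/
theorem of_sub_of_mem_M₁' {n : ℕ} (r r' z : KZ.IntegralRep n) (hd : r'.domain = r.domain)
    (hzd : z.domain = r.domain) (hz : ∀ x ∈ z.domain, z.integrand x = 0)
    (h : ∀ x ∈ r.domain, r.integrand x = r'.integrand x) : KZ.of r - KZ.of r' ∈ M₁ := by
  have hrel : KZ.of r - KZ.of r' - KZ.of z ∈ M₁ := by
    refine AddSubgroup.subset_closure (Or.inl (Or.inl (Or.inr ?_)))
    refine ⟨n, r, r', z, hd, hzd, ?_, rfl⟩
    intro x hx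
    simp [h x hx, hz x (hzd ▸ hx)]
  have hz0 : KZ.of z ∈ M₁ := of_mem_M₁_of_eqOn_zero' z hz
  have : KZ.of r - KZ.of r' = (KZ.of r - KZ.of r' - KZ.of z) + KZ.of z := by abel
  rw [this]
  exact M₁.add_mem hrel hz0

/-- `[r] + [r′] ∈ M₁` when the domains agree and the integrands are opposite on them. [folklore] -/
theorem of_add_of_mem_M₁' {n : ℕ} (r r' z : KZ.IntegralRep n) (hd : r'.domain = r.domain)
    (hzd : z.domain = r.domain) (hz : ∀ x ∈ z.domain, z.integrand x = 0)
    (h : ∀ x ∈ r.domain, r.integrand x + r'.integrand x = 0) : KZ.of r + KZ.of r' ∈ M₁ := by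
  -- 1b: `[z] − [r] − [r′]` with `0 = f + f′` on the domain
  have hrel : KZ.of z - KZ.of r - KZ.of r' ∈ M₁ := by
    refine AddSubgroup.subset_closure (Or.inl (Or.inl (Or.inr ?_)))
    refine ⟨n, z, r, r', hzd ▸ rfl, hd.trans hzd.symm, ?_, rfl⟩
    intro x hx
    simp [hz x hx, (h x (hzd ▸ hx)).symm]
  have hz0 : KZ.of z ∈ M₁ := of_mem_M₁_of_eqOn_zero' z hz
  have : KZ.of r + KZ.of r' = KZ.of z - (KZ.of z - KZ.of r - KZ.of r') := by abel
  rw [this]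
  exact M₁.sub_mem hz0 hrel

/-! ## §4 The reflection `t ↦ 1 − t` (rule 2 on `(0,1)`, `|det| = 1`) -/

/-- The reflection of `ℝ¹`, `z ↦ 1 − z`. [folklore] -/
def refl1 (z : Fin 1 → ℝ) : Fin 1 → ℝ := fun _ => 1 - z 0

/-- `refl1` maps `(0,1)` onto itself. [folklore] -/
theorem refl1_image : refl1 '' unitDom = unitDom := by
  ext w
  constructor
  · rintro ⟨z, hz, rfl⟩
    have hz' : z 0 ∈ Set.Ioo (0:ℝ) 1 := hz
    show (1 - z 0) ∈ Set.Ioo (0:ℝ) 1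
    exact ⟨by linarith [hz'.2], by linarith [hz'.1]⟩
  · intro hw
    have hw' : w 0 ∈ Set.Ioo (0:ℝ) 1 := hw
    refine ⟨refl1 w, ?_, ?_⟩
    · show (1 - w 0) ∈ Set.Ioo (0:ℝ) 1
      exact ⟨by linarith [hw'.2], by linarith [hw'.1]⟩
    · funext i
      have : i = 0 := Subsingleton.elim i 0
      subst this
      simp [refl1]

/-- Rule 2 along `t ↦ 1 − t`: if `f x = f′ (1 − x)` on `(0,1)` then `[∫_{(0,1)} f] − [∫_{(0,1)} f′] ∈ M₁`. [cite: KontsevichZagier2001, §1.2 rule (2)] -/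
theorem of_sub_of_refl_mem_M₁ (r r' : KZ.IntegralRep 1) (hr : r.domain = unitDom) (hr' : r'.domain = unitDom)
    (h : ∀ x ∈ unitDom, r.integrand x = r'.integrand (refl1 x)) : KZ.of r - KZ.of r' ∈ M₁ := by
  refine AddSubgroup.subset_closure (Or.inl (Or.inr ?_))
  set L : (Fin 1 → ℝ) →L[ℝ] (Fin 1 → ℝ) := (-1 : ℝ) • ContinuousLinearMap.id ℝ (Fin 1 → ℝ) with hL
  have hdet : |L.det| = 1 := by
    have : L.det = -1 := by
      rw [hL, ContinuousLinearMap.det, ContinuousLinearMap.toLinearMap_smul, LinearMap.det_smul,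
        ContinuousLinearMap.coe_id, LinearMap.det_id, Module.finrank_fin_fun ℝ]
      norm_num
    rw [this]; norm_num
  have hfun : refl1 = fun z : Fin 1 → ℝ => (fun _ => (1:ℝ)) - z := by
    funext z i
    have : i = 0 := Subsingleton.elim i 0
    subst this
    simp [refl1]
  have hderiv : ∀ x, HasFDerivAt refl1 L x := by
    intro x
    rw [hfun]
    have h := (hasFDerivAt_const (𝕜 := ℝ) (fun _ : Fin 1 => (1:ℝ)) x).sub (hasFDerivAt_id (𝕜 := ℝ) x)
    refine h.congr_fderiv ?_
    ext v i
    simp [hL]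
  refine ⟨1, r, r', refl1, fun _ => L, ?_, ?_, ?_, ?_, ?_, rfl⟩
  · rw [hr]
    refine (isSemialgebraicMapOn_aeval isSemialgebraic_unitDom
      (fun _ : Fin 1 => (1 - MvPolynomial.X 0 : MvPolynomial (Fin 1) ℚ))).congr ?_
    intro z _
    funext i
    simp [refl1]
  · intro x _
    exact (hderiv x).hasFDerivWithinAt
  · intro x _ y _ hxy
    have h0 : 1 - x 0 = 1 - y 0 := congrFun hxy 0
    funext i
    have : i = 0 := Subsingleton.elim i 0
    subst this
    linarith
  · rw [hr, hr', refl1_image]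
  · intro x hx
    rw [hdet, mul_one]
    exact h x (hr ▸ hx)


/-! ## §5 The point reflection `σ(a,b) = (1−a, 1−b)` of the plane and the reflected Green data -/

/-- `σ p = (1 − p₀, 1 − p₁)`. [folklore] -/
def σ2 (p : Fin 2 → ℝ) : Fin 2 → ℝ := ![1 - p 0, 1 - p 1]

@[simp] theorem σ2_apply_zero (p : Fin 2 → ℝ) : σ2 p 0 = 1 - p 0 := rfl

@[simp] theorem σ2_apply_one (p : Fin 2 → ℝ) : σ2 p 1 = 1 - p 1 := rfl

/-- `σ p = (1,1) − p`. [folklore] -/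
theorem σ2_eq (p : Fin 2 → ℝ) : σ2 p = ![1, 1] - p := by
  ext i
  fin_cases i <;> simp [σ2]

/-- `σ` is continuous. [folklore] -/
theorem continuous_σ2 : Continuous σ2 := by
  rw [show σ2 = fun p => ![1, 1] - p from funext σ2_eq]
  fun_prop

/-- `dσ = −id`. [folklore] -/
theorem hasFDerivAt_σ2 (p : Fin 2 → ℝ) :
    HasFDerivAt σ2 (-(ContinuousLinearMap.id ℝ (Fin 2 → ℝ))) p := by
  rw [show σ2 = fun p => ![1, 1] - p from funext σ2_eq]
  have h := (hasFDerivAt_const (𝕜 := ℝ) (![1, 1] : Fin 2 → ℝ) p).sub (hasFDerivAt_id (𝕜 := ℝ) p)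
  refine h.congr_fderiv ?_
  ext v i
  simp

/-- `σ(Δ) ⊆ Q`. [folklore] -/
theorem σ2_mapsTo : MapsTo σ2 Δ Q := by
  rintro p ⟨h0, h1, h2⟩
  refine ⟨?_, ?_, ?_, ?_⟩ <;> simp [σ2] <;> linarith

/-- `σ` is a `ℚ`-polynomial map on `Δ`. [folklore] -/
theorem isSemialgebraicMapOn_σ2 : IsSemialgebraicMapOn ℚ Δ σ2 := by
  refine (isSemialgebraicMapOn_aeval isSemialgebraic_Δ'
    (![1 - MvPolynomial.X 0, 1 - MvPolynomial.X 1] : Fin 2 → MvPolynomial (Fin 2) ℚ)).congr ?_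
  intro p _
  ext i
  fin_cases i <;> simp [σ2]

/-- Reflected coefficient `−F∘σ` is semialgebraic on `Δ` if `F` is on `Q`. [folklore] -/
theorem isSemialgebraicFunOn_reflect {F : (Fin 2 → ℝ) → ℝ} (hF : IsSemialgebraicFunOn ℚ Q F) :
    IsSemialgebraicFunOn ℚ Δ (fun p => -F (σ2 p)) :=
  (IsSemialgebraicFunOn.comp_isSemialgebraicMapOn_holds hF isSemialgebraicMapOn_σ2 σ2_mapsTo).neg

/-- Reflected coefficient `−F∘σ` is continuous on `Δ` if `F` is on `Q`. [folklore] -/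
theorem continuousOn_reflect {F : (Fin 2 → ℝ) → ℝ} (hF : ContinuousOn F Q) :
    ContinuousOn (fun p => -F (σ2 p)) Δ :=
  (hF.comp continuous_σ2.continuousOn σ2_mapsTo).neg

/-- The reflected potential: `d(S∘σ) = (−A∘σ) da + (−B∘σ) db` on the open triangle. [folklore] -/
theorem hasFDerivAt_reflect {A B S : (Fin 2 → ℝ) → ℝ}
    (hS : ∀ p : Fin 2 → ℝ, 0 < p 0 → p 0 < 1 → 0 < p 1 → p 1 < 1 →
      HasFDerivAt S (A p • ContinuousLinearMap.proj (R := ℝ) (φ := fun _ : Fin 2 => ℝ) 0 +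
        B p • ContinuousLinearMap.proj (R := ℝ) (φ := fun _ : Fin 2 => ℝ) 1) p)
    (p : Fin 2 → ℝ) (h0 : 0 < p 0) (h1 : 0 < p 1) (h2 : p 0 + p 1 < 1) :
    HasFDerivAt (fun p => S (σ2 p))
      ((-A (σ2 p)) • ContinuousLinearMap.proj (R := ℝ) (φ := fun _ : Fin 2 => ℝ) 0 +
        (-B (σ2 p)) • ContinuousLinearMap.proj (R := ℝ) (φ := fun _ : Fin 2 => ℝ) 1) p := by
  have hq := hS (σ2 p) (by simp [σ2]; linarith) (by simp [σ2]; linarith) (by simp [σ2]; linarith)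
    (by simp [σ2]; linarith)
  have h := hq.comp p (hasFDerivAt_σ2 p)
  refine h.congr_fderiv ?_
  ext v
  change A (σ2 p) * (-v) 0 + B (σ2 p) * (-v) 1 = -A (σ2 p) * v 0 + -B (σ2 p) * v 1
  simp only [Pi.neg_apply]
  ring

/-! ## §6 Green on the unit square with degenerate vertical sides -/

/-- **`stub_greenOnSquare`** (the registered stub's type verbatim). For typed Green data `(A, B, S)` on
the unit square `Q` with `B(0,·) = B(1,·) = 0` on `(0,1)`, the bottom and top edge representations agree
modulo `M₁`: the `Δ`-instance and the point-reflected instance of the typed Green generator, the hypotenuse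
densities cancelling by rule 2 along `t ↦ 1 − t` and 1b, the vertical densities vanishing (1b).
[cite: KontsevichZagier2001, §1.2] -/
theorem greenOnSquare : ∀ (A B S : (Fin 2 → ℝ) → ℝ), IsSemialgebraicFunOn ℚ {p : Fin 2 → ℝ | 0 ≤ p 0 ∧ p 0 ≤ 1 ∧ 0 ≤ p 1 ∧ p 1 ≤ 1} A → IsSemialgebraicFunOn ℚ {p : Fin 2 → ℝ | 0 ≤ p 0 ∧ p 0 ≤ 1 ∧ 0 ≤ p 1 ∧ p 1 ≤ 1} B → ContinuousOn A {p : Fin 2 → ℝ | 0 ≤ p 0 ∧ p 0 ≤ 1 ∧ 0 ≤ p 1 ∧ p 1 ≤ 1} → ContinuousOn B {p : Fin 2 → ℝ | 0 ≤ p 0 ∧ p 0 ≤ 1 ∧ 0 ≤ p 1 ∧ p 1 ≤ 1} → (∀ p : Fin 2 → ℝ, 0 < p 0 → p 0 < 1 → 0 < p 1 → p 1 < 1 → HasFDerivAt S (A p • ContinuousLinearMap.proj (R := ℝ) (φ := fun _ : Fin 2 => ℝ) 0 + B p • ContinuousLinearMap.proj (R := ℝ) (φ := fun _ : Fin 2 =>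 ℝ) 1) p) → (∀ t ∈ Set.Ioo (0 : ℝ) 1, B ![0, t] = 0) → (∀ t ∈ Set.Ioo (0 : ℝ) 1, B ![1, t] = 0) → ∀ (rB rT : KZ.IntegralRep 1), rB.domain = {z | z 0 ∈ Set.Ioo (0 : ℝ) 1} → rT.domain = {z | z 0 ∈ Set.Ioo (0 : ℝ) 1} → (∀ z ∈ rB.domain, rB.integrand z = A ![z 0, 0]) → (∀ z ∈ rT.domain, rT.integrand z = A ![z 0, 1]) → KZ.of rB - KZ.of rT ∈ AddSubgroup.closure (KZ.domainAddRel ∪ KZ.integrandAddRel ∪ KZ.changeOfVariablesRel ∪ {g : KZ.FormalRep | ∃ (Δ : Set (Fin 2 → ℝ)) (A B S : (Fin 2 → ℝ) → ℝ) (r₀₁ r₁₂ r₀₂ : KZ.IntegralRep 1), Δ = {p | 0 ≤ p 0 ∧ 0 ≤ p 1 ∧ p 0 + p 1 ≤ 1} ∧ IsSemialgebraicFunOn ℚ Δ A ∧ IsSemialgebraicFunOn ℚ Δ B ∧ ContinuousOn A Δ ∧ ContinuousOn B Δ ∧ (∀ p : Fin 2 → ℝ, 0 < p 0 → 0 < p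 1 → p 0 + p 1 < 1 → HasFDerivAt S (A p • ContinuousLinearMap.proj (R := ℝ) (φ := fun _ : Fin 2 => ℝ) 0 + B p • ContinuousLinearMap.proj (R := ℝ) (φ := fun _ : Fin 2 => ℝ) 1) p) ∧ r₀₁.domain = {z | z 0 ∈ Set.Ioo 0 1} ∧ r₁₂.domain = {z | z 0 ∈ Set.Ioo 0 1} ∧ r₀₂.domain = {z | z 0 ∈ Set.Ioo 0 1} ∧ (∀ z ∈ r₀₁.domain, r₀₁.integrand z = A ![z 0, 0]) ∧ (∀ z ∈ r₁₂.domain, r₁₂.integrand z = B ![1 - z 0, z 0] - A ![1 - z 0, z 0]) ∧ (∀ z ∈ r₀₂.domain, r₀₂.integrand z = B ![0, z 0]) ∧ g = KZ.of r₀₁ + KZ.of r₁₂ - KZ.of r₀₂}) := by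
  intro A B S hA hB hAc hBc hS hleft hright rB rT hrBd hrTd hrB hrT
  change KZ.of rB - KZ.of rT ∈ M₁
  change IsSemialgebraicFunOn ℚ Q A at hA
  change IsSemialgebraicFunOn ℚ Q B at hB
  change ContinuousOn A Q at hAc
  change ContinuousOn B Q at hBc
  -- membership facts for the edge maps
  have mem₁ : ∀ t ∈ Set.Icc (0:ℝ) 1, (![t, 0] : Fin 2 → ℝ) ∈ Q := fun t ht =>
    ⟨by simpa using ht.1, by simpa using ht.2, by simp, by simp⟩
  have mem₂ : ∀ t ∈ Set.Icc (0:ℝ) 1, (![1 - t, t] : Fin 2 → ℝ) ∈ Q := fun t ht =>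
    ⟨by simp; linarith [ht.2], by simp; linarith [ht.1], by simpa using ht.1, by simpa using ht.2⟩
  have mem₃ : ∀ t ∈ Set.Icc (0:ℝ) 1, (![0, t] : Fin 2 → ℝ) ∈ Q := fun t ht =>
    ⟨by simp, by simp, by simpa using ht.1, by simpa using ht.2⟩
  have mem₄ : ∀ t ∈ Set.Icc (0:ℝ) 1, (![1 - t, 1] : Fin 2 → ℝ) ∈ Q := fun t ht =>
    ⟨by simp; linarith [ht.2], by simp; linarith [ht.1], by simp, by simp⟩
  have mem₅ : ∀ t ∈ Set.Icc (0:ℝ) 1, (![t, 1 - t] : Fin 2 → ℝ) ∈ Q := fun t ht =>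
    ⟨by simpa using ht.1, by simpa using ht.2, by simp; linarith [ht.2], by simp; linarith [ht.1]⟩
  have mem₆ : ∀ t ∈ Set.Icc (0:ℝ) 1, (![1, 1 - t] : Fin 2 → ℝ) ∈ Q := fun t ht =>
    ⟨by simp, by simp, by simp; linarith [ht.2], by simp; linarith [ht.1]⟩
  have mem₇ : ∀ t ∈ Set.Icc (0:ℝ) 1, (![t, 1] : Fin 2 → ℝ) ∈ Q := fun t ht =>
    ⟨by simpa using ht.1, by simpa using ht.2, by simp, by simp⟩
  have Ioo_sub : ∀ z : Fin 1 → ℝ, z ∈ unitDom → z 0 ∈ Set.Icc (0:ℝ) 1 := fun z hz =>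
    ⟨le_of_lt (show z 0 ∈ Set.Ioo (0:ℝ) 1 from hz).1, le_of_lt (show z 0 ∈ Set.Ioo (0:ℝ) 1 from hz).2⟩
  -- semialgebraicity of the seven traces
  have sa₁ : ∀ {F}, IsSemialgebraicFunOn ℚ Q F → IsSemialgebraicFunOn ℚ unitDom (fun z => F ![z 0, 0]) :=
    fun hF => sa_comp hF (fun z => ![z 0, 0]) ![MvPolynomial.X 0, 0]
      (fun z => by ext j; fin_cases j <;> simp) (fun z hz => mem₁ (z 0) (Ioo_sub z hz))
  have sa₂ : ∀ {F}, IsSemialgebraicFunOn ℚ Q F → IsSemialgebraicFunOn ℚ unitDom (fun z => F ![1 - z 0, z 0]) :=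
    fun hF => sa_comp hF (fun z => ![1 - z 0, z 0]) ![1 - MvPolynomial.X 0, MvPolynomial.X 0]
      (fun z => by ext j; fin_cases j <;> simp) (fun z hz => mem₂ (z 0) (Ioo_sub z hz))
  have sa₃ : ∀ {F}, IsSemialgebraicFunOn ℚ Q F → IsSemialgebraicFunOn ℚ unitDom (fun z => F ![0, z 0]) :=
    fun hF => sa_comp hF (fun z => ![0, z 0]) ![0, MvPolynomial.X 0]
      (fun z => by ext j; fin_cases j <;> simp) (fun z hz => mem₃ (z 0) (Ioo_sub z hz))
  have sa₄ : ∀ {F}, IsSemialgebraicFunOn ℚ Q F → IsSemialgebraicFunOn ℚ unitDom (fun z => F ![1 - z 0, 1]) :=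
    fun hF => sa_comp hF (fun z => ![1 - z 0, 1]) ![1 - MvPolynomial.X 0, 1]
      (fun z => by ext j; fin_cases j <;> simp) (fun z hz => mem₄ (z 0) (Ioo_sub z hz))
  have sa₅ : ∀ {F}, IsSemialgebraicFunOn ℚ Q F → IsSemialgebraicFunOn ℚ unitDom (fun z => F ![z 0, 1 - z 0]) :=
    fun hF => sa_comp hF (fun z => ![z 0, 1 - z 0]) ![MvPolynomial.X 0, 1 - MvPolynomial.X 0]
      (fun z => by ext j; fin_cases j <;> simp) (fun z hz => mem₅ (z 0) (Ioo_sub z hz))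
  have sa₆ : ∀ {F}, IsSemialgebraicFunOn ℚ Q F → IsSemialgebraicFunOn ℚ unitDom (fun z => F ![1, 1 - z 0]) :=
    fun hF => sa_comp hF (fun z => ![1, 1 - z 0]) ![1, 1 - MvPolynomial.X 0]
      (fun z => by ext j; fin_cases j <;> simp) (fun z hz => mem₆ (z 0) (Ioo_sub z hz))
  have sa₇ : ∀ {F}, IsSemialgebraicFunOn ℚ Q F → IsSemialgebraicFunOn ℚ unitDom (fun z => F ![z 0, 1]) :=
    fun hF => sa_comp hF (fun z => ![z 0, 1]) ![MvPolynomial.X 0, 1]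
      (fun z => by ext j; fin_cases j <;> simp) (fun z hz => mem₇ (z 0) (Ioo_sub z hz))
  -- integrability of the seven traces
  have c2 : ∀ (f g : ℝ → ℝ), Continuous f → Continuous g → Continuous fun t => (![f t, g t] : Fin 2 → ℝ) := by
    intro f g hf hg
    refine continuous_pi fun i => ?_
    fin_cases i
    · simpa using hf
    · simpa using hg
  have int₁ : ∀ {F}, ContinuousOn F Q → IntegrableOn (fun z : Fin 1 → ℝ => F ![z 0, 0]) unitDom volume :=
    fun hF => integrableOn_comp hF (fun t => ![t, 0]) (c2 _ _ continuous_id continuous_const) mem₁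
  have int₂ : ∀ {F}, ContinuousOn F Q → IntegrableOn (fun z : Fin 1 → ℝ => F ![1 - z 0, z 0]) unitDom volume :=
    fun hF => integrableOn_comp hF (fun t => ![1 - t, t]) (c2 _ _ (by fun_prop) continuous_id) mem₂
  have int₃ : ∀ {F}, ContinuousOn F Q → IntegrableOn (fun z : Fin 1 → ℝ => F ![0, z 0]) unitDom volume :=
    fun hF => integrableOn_comp hF (fun t => ![0, t]) (c2 _ _ continuous_const continuous_id) mem₃
  have int₄ : ∀ {F}, ContinuousOn F Q → IntegrableOn (fun z : Fin 1 → ℝ => F ![1 - z 0, 1]) unitDom volume :=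
    fun hF => integrableOn_comp hF (fun t => ![1 - t, 1]) (c2 _ _ (by fun_prop) continuous_const) mem₄
  have int₅ : ∀ {F}, ContinuousOn F Q → IntegrableOn (fun z : Fin 1 → ℝ => F ![z 0, 1 - z 0]) unitDom volume :=
    fun hF => integrableOn_comp hF (fun t => ![t, 1 - t]) (c2 _ _ continuous_id (by fun_prop)) mem₅
  have int₆ : ∀ {F}, ContinuousOn F Q → IntegrableOn (fun z : Fin 1 → ℝ => F ![1, 1 - z 0]) unitDom volume :=
    fun hF => integrableOn_comp hF (fun t => ![1, 1 - t]) (c2 _ _ continuous_const (by fun_prop)) mem₆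
  have int₇ : ∀ {F}, ContinuousOn F Q → IntegrableOn (fun z : Fin 1 → ℝ => F ![z 0, 1]) unitDom volume :=
    fun hF => integrableOn_comp hF (fun t => ![t, 1]) (c2 _ _ continuous_id continuous_const) mem₇
  -- the zero representation on (0,1)
  let zr : KZ.IntegralRep 1 := edgeRep (fun _ => 0)
    (by simpa using isSemialgebraicFunOn_ratConst isSemialgebraic_unitDom 0) integrableOn_zero
  -- instance 1: edges of `Δ` with data `(A, B, S)`
  let r₁ : KZ.IntegralRep 1 := edgeRep (fun z => A ![z 0, 0]) (sa₁ hA) (int₁ hAc)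
  let r₂ : KZ.IntegralRep 1 := edgeRep (fun z => B ![1 - z 0, z 0] - A ![1 - z 0, z 0])
    (IsSemialgebraicFunOn.sub_holds (sa₂ hB) (sa₂ hA)) ((int₂ hBc).sub (int₂ hAc))
  let r₃ : KZ.IntegralRep 1 := edgeRep (fun z => B ![0, z 0]) (sa₃ hB) (int₃ hBc)
  -- instance 2: data `(−A∘σ, −B∘σ, S∘σ)`
  let A₂ : (Fin 2 → ℝ) → ℝ := fun p => -A (σ2 p)
  let B₂ : (Fin 2 → ℝ) → ℝ := fun p => -B (σ2 p)
  let S₂ : (Fin 2 → ℝ) → ℝ := fun p => S (σ2 p)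
  -- the reflected edge traces, rewritten
  have eσ₁ : ∀ z : Fin 1 → ℝ, σ2 ![z 0, 0] = ![1 - z 0, 1] := fun z => by
    ext i; fin_cases i <;> simp [σ2]
  have eσ₂ : ∀ z : Fin 1 → ℝ, σ2 ![1 - z 0, z 0] = ![z 0, 1 - z 0] := fun z => by
    ext i; fin_cases i <;> simp [σ2]
  have eσ₃ : ∀ z : Fin 1 → ℝ, σ2 ![0, z 0] = ![1, 1 - z 0] := fun z => by
    ext i; fin_cases i <;> simp [σ2]
  have hf₁' : (fun z : Fin 1 → ℝ => A₂ ![z 0, 0]) = fun z => -A ![1 - z 0, 1] := by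
    funext z; simp [A₂, eσ₁]
  have hf₂' : (fun z : Fin 1 → ℝ => B₂ ![1 - z 0, z 0] - A₂ ![1 - z 0, z 0]) =
      fun z => -B ![z 0, 1 - z 0] + A ![z 0, 1 - z 0] := by
    funext z; simp [A₂, B₂, eσ₂]
  have hf₃' : (fun z : Fin 1 → ℝ => B₂ ![0, z 0]) = fun z => -B ![1, 1 - z 0] := by
    funext z; simp [B₂, eσ₃]
  let r₁' : KZ.IntegralRep 1 := edgeRep (fun z => A₂ ![z 0, 0])
    (by rw [hf₁']; exact (sa₄ hA).neg) (by rw [hf₁']; exact (int₄ hAc).neg)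
  let r₂' : KZ.IntegralRep 1 := edgeRep (fun z => B₂ ![1 - z 0, z 0] - A₂ ![1 - z 0, z 0])
    (by rw [hf₂']; exact IsSemialgebraicFunOn.add_holds (sa₅ hB).neg (sa₅ hA))
    (by rw [hf₂']; exact (int₅ hBc).neg.add (int₅ hAc))
  let r₃' : KZ.IntegralRep 1 := edgeRep (fun z => B₂ ![0, z 0])
    (by rw [hf₃']; exact (sa₆ hB).neg) (by rw [hf₃']; exact (int₆ hBc).neg)
  -- auxiliary representations for the rule-2 / 1b bookkeeping
  let nT : KZ.IntegralRep 1 := edgeRep (fun z => -A ![z 0, 1]) (sa₇ hA).neg (int₇ hAc).neg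
  let W : KZ.IntegralRep 1 := edgeRep (fun z => -(B ![1 - z 0, z 0] - A ![1 - z 0, z 0]))
    (IsSemialgebraicFunOn.sub_holds (sa₂ hB) (sa₂ hA)).neg ((int₂ hBc).sub (int₂ hAc)).neg
  -- the two Green instances
  have hopen : ∀ p : Fin 2 → ℝ, 0 < p 0 → 0 < p 1 → p 0 + p 1 < 1 →
      HasFDerivAt S (A p • ContinuousLinearMap.proj (R := ℝ) (φ := fun _ : Fin 2 => ℝ) 0 +
        B p • ContinuousLinearMap.proj (R := ℝ) (φ := fun _ : Fin 2 => ℝ) 1) p :=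
    fun p h0 h1 h2 => hS p h0 (by linarith) h1 (by linarith)
  have g₁ : KZ.of r₁ + KZ.of r₂ - KZ.of r₃ ∈ M₁ := by
    refine AddSubgroup.subset_closure (Or.inr ⟨Δ, A, B, S, r₁, r₂, r₃, rfl,
      hA.mono Δ_subset_Q isSemialgebraic_Δ', hB.mono Δ_subset_Q isSemialgebraic_Δ',
      hAc.mono Δ_subset_Q, hBc.mono Δ_subset_Q, hopen, rfl, rfl, rfl,
      fun z _ => rfl, fun z _ => rfl, fun z _ => rfl, rfl⟩)
  have g₂ : KZ.of r₁' + KZ.of r₂' - KZ.of r₃' ∈ M₁ := by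
    refine AddSubgroup.subset_closure (Or.inr ⟨Δ, A₂, B₂, S₂, r₁', r₂', r₃', rfl,
      isSemialgebraicFunOn_reflect hA, isSemialgebraicFunOn_reflect hB,
      continuousOn_reflect hAc, continuousOn_reflect hBc,
      fun p h0 h1 h2 => hasFDerivAt_reflect hS p h0 h1 h2, rfl, rfl, rfl,
      fun z _ => rfl, fun z _ => rfl, fun z _ => rfl, rfl⟩)
  -- bookkeeping
  have hrBd' : rB.domain = unitDom := hrBd
  have hrTd' : rT.domain = unitDom := hrTd
  have e₁ : KZ.of rB - KZ.of r₁ ∈ M₁ :=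
    of_sub_of_mem_M₁' rB r₁ zr (by rw [hrBd']; rfl) (by rw [hrBd']; rfl) (fun _ _ => rfl)
      (fun x hx => hrB x hx)
  have e₃ : KZ.of r₃ ∈ M₁ := of_mem_M₁_of_eqOn_zero' r₃ (fun x hx => hleft (x 0) hx)
  have e₃' : KZ.of r₃' ∈ M₁ := by
    refine of_mem_M₁_of_eqOn_zero' r₃' (fun x hx => ?_)
    have hx' : x 0 ∈ Set.Ioo (0:ℝ) 1 := hx
    show B₂ ![0, x 0] = 0
    have h := hright (1 - x 0) ⟨by linarith [hx'.2], by linarith [hx'.1]⟩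
    simp [B₂, eσ₃, h]
  have e₄ : KZ.of r₁' + KZ.of rT ∈ M₁ := by
    have h1 : KZ.of r₁' - KZ.of nT ∈ M₁ := by
      refine of_sub_of_refl_mem_M₁ r₁' nT rfl rfl (fun x _ => ?_)
      show A₂ ![x 0, 0] = -A ![(refl1 x) 0, 1]
      simp [A₂, eσ₁, refl1]
    have h2 : KZ.of nT + KZ.of rT ∈ M₁ := by
      refine of_add_of_mem_M₁' nT rT zr hrTd' rfl (fun _ _ => rfl) (fun x hx => ?_)
      show -A ![x 0, 1] + rT.integrand x = 0
      rw [hrT x (hrTd' ▸ hx)]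
      ring
    have : KZ.of r₁' + KZ.of rT = (KZ.of r₁' - KZ.of nT) + (KZ.of nT + KZ.of rT) := by abel
    rw [this]
    exact M₁.add_mem h1 h2
  have e₅ : KZ.of r₂ + KZ.of r₂' ∈ M₁ := by
    have h1 : KZ.of r₂' - KZ.of W ∈ M₁ := by
      refine of_sub_of_refl_mem_M₁ r₂' W rfl rfl (fun x _ => ?_)
      show B₂ ![1 - x 0, x 0] - A₂ ![1 - x 0, x 0] =
        -(B ![1 - (refl1 x) 0, (refl1 x) 0] - A ![1 - (refl1 x) 0, (refl1 x) 0])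
      simp [A₂, B₂, eσ₂, refl1]
      ring
    have h2 : KZ.of W + KZ.of r₂ ∈ M₁ := by
      refine of_add_of_mem_M₁' W r₂ zr rfl rfl (fun _ _ => rfl) (fun x _ => ?_)
      show -(B ![1 - x 0, x 0] - A ![1 - x 0, x 0]) + (B ![1 - x 0, x 0] - A ![1 - x 0, x 0]) = 0
      ring
    have : KZ.of r₂ + KZ.of r₂' = (KZ.of r₂' - KZ.of W) + (KZ.of W + KZ.of r₂) := by abel
    rw [this]
    exact M₁.add_mem h1 h2
  -- assembly
  have key : KZ.of rB - KZ.of rT = (KZ.of rB - KZ.of r₁) + (KZ.of r₁ + KZ.of r₂ - KZ.of r₃) +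
      (KZ.of r₁' + KZ.of r₂' - KZ.of r₃') - (KZ.of r₂ + KZ.of r₂') + KZ.of r₃ + KZ.of r₃' -
      (KZ.of r₁' + KZ.of rT) := by abel
  rw [key]
  exact M₁.sub_mem (M₁.add_mem (M₁.add_mem (M₁.sub_mem (M₁.add_mem (M₁.add_mem e₁ g₁) g₂) e₅) e₃) e₃') e₄

end Summit.KontsevichZagierPeriods.SymplecticScissors.RealOnePeriodRelations.GreenOnSquareProof

end
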